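import Mathlib
import Literature.Computability.Complexity.CliqueTestGraphs
import Literature.Computability.Complexity.CliqueApproximators
import HarnessLib

/-!
# Route FifoMatching — crux `NNNotVP` (stmt-ValiantsHypothesis-11615), line `division_split`:
# the CLIQUE TOKEN PROGRAM (objects) for stub A `stub_supportFnHard`

Definitions file (objects the line posits) for the clique gadget of stub A, in the token-program
form sealed by `exists_programProjection` (`Theorems/FifoMatchingNNNotVPProgram.lean`; design
record in the docstring of `…TokenGame`).  A token program with `k` tokens and position space
`Pos k m` is a labelling of arcs by `KEdge m ⊕ Bool`; here is the program whose runs on a graph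
vector `y : KEdge m → Bool` are meant to be exactly "guess `k` vertices `a₀,…,a_{k-1}` and check
every pair `{a_i, a_{i-r}}` is an edge", the pair `(i, i-r)` being brought together by a systolic
SHIFT of a travelling register `b` (`b_i(r) = a_{i-r}`), whose one-step move `c_i := b_{i-1}` is
forced by two BUCKET FILTERS (non-crossing of interleaved lexicographic positions).

* `Regs m = Fin m × Fin (m+1) × Fin (m+1)` — registers `(a, b, c)`: own vertex, travelling
  value, staged value (`Fin.last m` = blank); packed into `Fin (regCard m)` by `regEquiv`;
* `Pos k m = Fin k ×ₗ (Fin (m+1) ×ₗ (Fin 2 ×ₗ Fin (regCard m)))` — positions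
  `filt blk key side w` (block, bucket, side, packed registers); `home i w = filt i 0 0 w`;
  projections `blkOf`, `keyOf`, `sideOf`, `valOf`; register access `aOf`, `bOf`, `cOf`, `mkRegs`;
* the five round kinds `labA` (even pairs `≤`, odd tokens stage `c`), `labB = labD` (reverse the
  buckets: `≥`), `labC` (odd pairs `≤`, even tokens `≥ 2` stage `c`, token `0` stages blank),
  `labE` (commit `b := c`, CHECK the edge `{a, c}` unless `c` is blank, go home), the initial
  labelling `lab0` (GUESS `a`, `b := a`, `c := blank`), the edge label `chk`, and the program
  `cliqueLab k m : Fin R → Pos k m → Pos k m → KEdge m ⊕ Bool` (round `j` has kind `j % 5`).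

No statement is asserted here.  Honest framing: vocabulary only; whether this program is a
clique-like projection (ACCEPT on `⌊√m⌋`-clique vectors, REJECT on `(⌊√m⌋-1)`-colouring vectors)
is proved in the companion theorem files, the crux `NNNotVP` is OPEN and nothing here bears on
`VP ≠ VNP`.
-/

noncomputable section

-- Sub = Summit single-conjunct layout: the duplicated namespace component is mandated by the tree.
set_option linter.dupNamespace false

namespace Summit.ValiantsHypothesis.ValiantsHypothesis.Theorems.FifoMatching.NNNotVP.DivisionSplit

open Literature.Computability.Complexity
open scoped Classical

/-- Registers of a token: `(a, b, c)` = own vertex, travelling value, staged value; the value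
`Fin.last m` of `b` / `c` is the blank. [folklore] -/
abbrev Regs (m : ℕ) : Type := Fin m × Fin (m + 1) × Fin (m + 1)

/-- Number of register states. [folklore] -/
abbrev regCard (m : ℕ) : ℕ := Fintype.card (Regs m)

/-- Packing of register states into `Fin (regCard m)`. [folklore] -/
def regEquiv (m : ℕ) : Fin (regCard m) ≃ Regs m := (Fintype.equivFin (Regs m)).symm

/-- Positions of the clique program: (block, bucket, side, packed registers), ordered
lexicographically. [folklore] -/
abbrev Pos (k m : ℕ) : Type := Fin k ×ₗ (Fin (m + 1) ×ₗ (Fin 2 ×ₗ Fin (regCard m)))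

variable {k m : ℕ}

/-- The position with the given block, bucket, side and registers. [folklore] -/
def filt (blk : Fin k) (key : Fin (m + 1)) (s : Fin 2) (w : Fin (regCard m)) : Pos k m :=
  toLex (blk, toLex (key, toLex (s, w)))

/-- The HOME position of token `i` with registers `w`: block `i`, bucket `0`, side `0`.
[folklore] -/
def home (i : Fin k) (w : Fin (regCard m)) : Pos k m := filt i 0 0 w

/-- Block of a position. [folklore] -/
def blkOf (q : Pos k m) : Fin k := (ofLex q).1
/-- Bucket of a position. [folklore] -/
def keyOf (q : Pos k m) : Fin (m + 1) := (ofLex (ofLex q).2).1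
/-- Side of a position. [folklore] -/
def sideOf (q : Pos k m) : Fin 2 := (ofLex (ofLex (ofLex q).2).2).1
/-- Packed registers of a position. [folklore] -/
def valOf (q : Pos k m) : Fin (regCard m) := (ofLex (ofLex (ofLex q).2).2).2

/-- Register `a` (own vertex). [folklore] -/
def aOf (w : Fin (regCard m)) : Fin m := (regEquiv m w).1
/-- Register `b` (travelling value). [folklore] -/
def bOf (w : Fin (regCard m)) : Fin (m + 1) := (regEquiv m w).2.1
/-- Register `c` (staged value). [folklore] -/
def cOf (w : Fin (regCard m)) : Fin (m + 1) := (regEquiv m w).2.2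
/-- Packed registers with the given values. [folklore] -/
def mkRegs (a : Fin m) (b c : Fin (m + 1)) : Fin (regCard m) := (regEquiv m).symm (a, b, c)

/-- Reversed bucket `m - key` (turns the `≤` filter into a `≥` filter). [folklore] -/
def revKey (key : Fin (m + 1)) : Fin (m + 1) := Fin.rev key

/-- The CHECK label of registers `(a, c)`: free if `c` is blank, absent if `c = a`, else the edge
`{a, c}` of `K_m`. [folklore] -/
def chk (a : Fin m) (c : Fin (m + 1)) : KEdge m ⊕ Bool :=
  if h : c.val < m then
    (if h' : a = ⟨c.val, h⟩ then Sum.inr false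
      else Sum.inl ⟨s(a, ⟨c.val, h⟩), by
        rw [SimpleGraph.mem_edgeSet, SimpleGraph.top_adj]; exact h'⟩)
  else Sum.inr true

/-- Round kind A (from home positions): an even token `i` goes to `filt i b 0 w`; an odd token
`i` stages any `κ` into `c` and goes to `filt (i-1) κ 1 w'`. [folklore] -/
def labA (q q' : Pos k m) : KEdge m ⊕ Bool :=
  if keyOf q = 0 ∧ sideOf q = 0 then
    (if (blkOf q).val % 2 = 0 then
      (if q' = filt (blkOf q) (bOf (valOf q)) 0 (valOf q) then Sum.inr true else Sum.inr false)
    else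
      (if ∃ κ : Fin (m + 1), q' = filt ⟨(blkOf q).val - 1, by omega⟩ κ 1
          (mkRegs (aOf (valOf q)) (bOf (valOf q)) κ) then Sum.inr true else Sum.inr false))
  else Sum.inr false

/-- Round kinds B and D: reverse the bucket. [folklore] -/
def labB (q q' : Pos k m) : KEdge m ⊕ Bool :=
  if q' = filt (blkOf q) (revKey (keyOf q)) (sideOf q) (valOf q) then Sum.inr true
  else Sum.inr false

/-- Round kind C (from B-positions): a side-`0` token in block `0` (token `0`) stages blank and
goes home; a side-`0` token in block `i ≥ 1` (even token `i`) stages any `κ` and goes to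
`filt (i-1) κ 1 w'`; a side-`1` token in block `i` (odd token `i+1`) goes to `filt (i+1) b 0 w`.
[folklore] -/
def labC (q q' : Pos k m) : KEdge m ⊕ Bool :=
  if sideOf q = 0 then
    (if (blkOf q).val = 0 then
      (if q' = home (blkOf q) (mkRegs (aOf (valOf q)) (bOf (valOf q)) (Fin.last m))
        then Sum.inr true else Sum.inr false)
    else
      (if ∃ κ : Fin (m + 1), q' = filt ⟨(blkOf q).val - 1, by omega⟩ κ 1
          (mkRegs (aOf (valOf q)) (bOf (valOf q)) κ) then Sum.inr true else Sum.inr false))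
  else
    (if h : (blkOf q).val + 1 < k then
      (if q' = filt ⟨(blkOf q).val + 1, h⟩ (bOf (valOf q)) 0 (valOf q) then Sum.inr true
        else Sum.inr false)
    else Sum.inr false)

/-- Round kind E (from D-positions): token `i` (= block for side `0`, block `+ 1` for side `1`)
commits `b := c`, goes home, along an arc labelled `chk a c`. [folklore] -/
def labE (q q' : Pos k m) : KEdge m ⊕ Bool :=
  if h : (blkOf q).val + (sideOf q).val < k then
    (if q' = home ⟨(blkOf q).val + (sideOf q).val, h⟩
        (mkRegs (aOf (valOf q)) (cOf (valOf q)) (cOf (valOf q)))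
      then chk (aOf (valOf q)) (cOf (valOf q)) else Sum.inr false)
  else Sum.inr false

/-- Initial labelling (GUESS): token `i` enters `home i (a, a, blank)` for any vertex `a`.
[folklore] -/
def lab0 (i : Fin k) (q : Pos k m) : KEdge m ⊕ Bool :=
  if ∃ a : Fin m, q = home i (mkRegs a (Fin.castSucc a) (Fin.last m)) then Sum.inr true
  else Sum.inr false

/-- The clique program: round `j` has kind `j % 5` (A, B, C, D = B, E). [folklore] -/
def cliqueLab {R : ℕ} (j : Fin R) (q q' : Pos k m) : KEdge m ⊕ Bool :=
  if j.val % 5 = 0 then labA q q'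
  else if j.val % 5 = 1 then labB q q'
  else if j.val % 5 = 2 then labC q q'
  else if j.val % 5 = 3 then labB q q'
  else labE q q'

end Summit.ValiantsHypothesis.ValiantsHypothesis.Theorems.FifoMatching.NNNotVP.DivisionSplit

end
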